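import Literature.NumberTheory.Automorphic.CongruenceSubgroupPropertySL2Lemma1
import Literature.NumberTheory.Automorphic.CongruenceSubgroupPropertySL2UnitOrders
import HarnessLib

/-!
# Serre's congruence subgroup property for `SL₂(𝓞_F)` — proofs, XII: Vaserstein's Lemma 5

Topic `Literature/NumberTheory/Automorphic`; namespace `Literature.NumberTheory.Automorphic.SL2Rel`.
Everything here is PROVED; one auxiliary definition, `SL2Rel.diagHom : Rˣ →* SL(2, R)`,
`u ↦ diag(u, u⁻¹)`.

**Vaserstein 1972, Lemma 5**: *let `t ∈ GL₁(A)`, `T = diag(t, t⁻¹)`, `I` a non-zero ideal,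
`B = (a b; c d) ∈ SL₂(A)` with `b, c ∈ I`, `s = m/2` half the number of roots of unity in `k`;
then `Tˢ B T⁻ˢ ∈ E(I, I) B E(I, I)`.*  Here `A = 𝓞 K` for a number field `K` with a real place, so
`m = 2`, `s = 1` (`SL2Rel.exists_diagHom_conj_eq`).  Proof as printed (p. 318–319): since `T`
normalises `E(I, I)` the good exponents `n` form a subgroup of `ℤ` (`goodExponents`); it contains
every `n` with `t²ⁿ ≡ 1 (mod a + xb²)` for some `x` (the explicit computation
`Tⁿ B E₂₁(xb) T⁻ⁿ E(I, I) = (a + xb², b; *, *) E(I, I) = (a, b; *, *) E(I, I) ⊆ E(I, I) B E(I, I)`,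
`diagHom_conj_mem_of_dvd`); and — replacing Vaserstein's appeal to class field theory ("Lemma 3 of
[2]" = Serre's Lemme 3: the g.c.d. of the orders of `t` modulo the `a + xb²` divides `m`) by the
tree's `SerreSL2.exists_add_mul_forall_not_dvd_orderOf` — for every prime `l` it contains an `n`
prime to `l`, hence equals `ℤ`.

## References

* [Vaserstein1972SL2] L. N. Vaserstein, Mat. Sb. 89 (131) (1972) 313–322, Lemma 5 (pp. 317–319).
* [SerreSL2Congruence1970] J.-P. Serre, Ann. of Math. 92 (1970), §2.2 Lemme 3.
-/

open Matrix MatrixGroups NumberField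

namespace Literature.NumberTheory.Automorphic

namespace SL2Rel

/-! ### Diagonal matrices -/

section CommRing

variable {R : Type*} [CommRing R]

/-- `diag(u, u⁻¹) ∈ SL₂(R)` for a unit `u`, as a homomorphism `Rˣ → SL₂(R)`. [folklore] -/
def diagHom : Rˣ →* SL(2, R) where
  toFun u := ⟨!![(u : R), 0; 0, ↑u⁻¹], by simp [Matrix.det_fin_two_of]⟩
  map_one' := by
    ext i j
    fin_cases i <;> fin_cases j <;> simp
  map_mul' u v := by
    ext i j
    fin_cases i <;> fin_cases j <;>
      simp [Matrix.mul_apply, Fin.sum_univ_two, mul_comm]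

/-- Entry `(0,0)` of `diag(u, u⁻¹)`. [folklore] -/
@[simp] theorem diagHom_apply_00 (u : Rˣ) : (diagHom u : SL(2, R)) 0 0 = u := rfl

/-- Entry `(0,1)` of `diag(u, u⁻¹)`. [folklore] -/
@[simp] theorem diagHom_apply_01 (u : Rˣ) : (diagHom u : SL(2, R)) 0 1 = 0 := rfl

/-- Entry `(1,0)` of `diag(u, u⁻¹)`. [folklore] -/
@[simp] theorem diagHom_apply_10 (u : Rˣ) : (diagHom u : SL(2, R)) 1 0 = 0 := rfl

/-- Entry `(1,1)` of `diag(u, u⁻¹)`. [folklore] -/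
@[simp] theorem diagHom_apply_11 (u : Rˣ) : (diagHom u : SL(2, R)) 1 1 = ↑u⁻¹ := rfl

/-- Entries of `D M D⁻¹`, `D = diag(u, u⁻¹)`. [folklore] -/
theorem diagHom_conj_apply (u : Rˣ) (M : SL(2, R)) :
    (diagHom u * M * (diagHom u)⁻¹) 0 0 = M 0 0 ∧
    (diagHom u * M * (diagHom u)⁻¹) 0 1 = u * u * M 0 1 ∧
    (diagHom u * M * (diagHom u)⁻¹) 1 0 = ↑u⁻¹ * ↑u⁻¹ * M 1 0 ∧
    (diagHom u * M * (diagHom u)⁻¹) 1 1 = M 1 1 := by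
  obtain ⟨i00, i01, i10, i11⟩ := inv_apply_two (diagHom u : SL(2, R))
  have hinv : (u : R) * ↑u⁻¹ = 1 := u.mul_inv
  simp only [mul_apply_two, i00, i01, i10, i11, diagHom_apply_00, diagHom_apply_01,
    diagHom_apply_10, diagHom_apply_11]
  refine ⟨?_, ?_, ?_, ?_⟩
  · linear_combination (M 0 0) * hinv
  · ring
  · ring
  · linear_combination (M 1 1) * hinv

/-- `D E₁₂(x) D⁻¹ = E₁₂(u²x)`. [folklore] -/
theorem diagHom_conj_e12 (u : Rˣ) (x : R) :
    diagHom u * e12 x * (diagHom u)⁻¹ = e12 (u * u * x) := by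
  obtain ⟨h00, h01, h10, h11⟩ := diagHom_conj_apply u (e12 x)
  ext i j
  fin_cases i <;> fin_cases j
  · simpa using h00
  · simpa using h01
  · simpa using h10
  · simpa using h11

/-- `D E₂₁(y) D⁻¹ = E₂₁(u⁻²y)`. [folklore] -/
theorem diagHom_conj_e21 (u : Rˣ) (y : R) :
    diagHom u * e21 y * (diagHom u)⁻¹ = e21 (↑u⁻¹ * ↑u⁻¹ * y) := by
  obtain ⟨h00, h01, h10, h11⟩ := diagHom_conj_apply u (e21 y)
  ext i j
  fin_cases i <;> fin_cases j
  · simpa using h00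
  · simpa using h01
  · simpa using h10
  · simpa using h11

/-- `diag(u, u⁻¹)` normalises `E(I₁, I₂)`. [cite: Vaserstein1972SL2, Lemma 5 (proof)] -/
theorem conj_diagHom_mem_relE {I₁ I₂ : Ideal R} (u : Rˣ) {E : SL(2, R)} (hE : E ∈ relE I₁ I₂) :
    diagHom u * E * (diagHom u)⁻¹ ∈ relE I₁ I₂ := by
  have h : (relE I₁ I₂).map (MulAut.conj (diagHom u)).toMonoidHom ≤ relE I₁ I₂ := by
    rw [relE, MonoidHom.map_closure, Subgroup.closure_le]
    rintro _ ⟨M, hM | hM, rfl⟩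
    · obtain ⟨x, hx, rfl⟩ := hM
      rw [MulEquiv.coe_toMonoidHom, MulAut.conj_apply, diagHom_conj_e12]
      exact e12_mem_relE (I₁.mul_mem_left _ hx)
    · obtain ⟨y, hy, rfl⟩ := hM
      rw [MulEquiv.coe_toMonoidHom, MulAut.conj_apply, diagHom_conj_e21]
      exact e21_mem_relE (I₂.mul_mem_left _ hy)
  exact h (Subgroup.mem_map_of_mem _ hE)

/-- `diag(u, u⁻¹)⁻¹` normalises `E(I₁, I₂)`. [cite: Vaserstein1972SL2, Lemma 5 (proof)] -/
theorem diagHom_inv_conj_mem_relE {I₁ I₂ : Ideal R} (u : Rˣ) {E : SL(2, R)}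
    (hE : E ∈ relE I₁ I₂) : (diagHom u)⁻¹ * E * diagHom u ∈ relE I₁ I₂ := by
  simpa using conj_diagHom_mem_relE u⁻¹ hE

/-- Two matrices of `SL₂` with the same first row differ by a left factor `E₂₁(μ)`. [folklore] -/
theorem eq_e21_mul_of_row_eq (M B : SL(2, R)) (h0 : M 0 0 = B 0 0) (h1 : M 0 1 = B 0 1) :
    M = e21 (M 1 0 * B 1 1 - M 1 1 * B 1 0) * B := by
  have hM := det_two M
  have hB := det_two B
  obtain ⟨i00, i01, i10, i11⟩ := inv_apply_two B
  rw [← mul_inv_eq_iff_eq_mul]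
  ext i j
  fin_cases i <;> fin_cases j <;>
    simp only [mul_apply_two, i00, i01, i10, i11, e21_apply_00, e21_apply_01, e21_apply_10,
      e21_apply_11, Fin.zero_eta, Fin.isValue, Fin.mk_one]
  · rw [h0, h1]; linear_combination hB
  · rw [h0, h1]; ring
  · ring
  · rw [← h0, ← h1]; linear_combination hM

/-- **The computation in Lemma 5**: if `v² - 1 = (a + xb²) r` then
`D B D⁻¹ ∈ E(I, I) B E(I, I)` for `D = diag(v, v⁻¹)`, `B = (a b; c d)`, `b, c ∈ I`.
[cite: Vaserstein1972SL2, Lemma 5 (proof)] -/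
theorem diagHom_conj_mem_of_dvd {I : Ideal R} (v : Rˣ) (B : SL(2, R)) (hb : B 0 1 ∈ I)
    (hc : B 1 0 ∈ I) (x r : R) (hr : (v : R) * v - 1 = (B 0 0 + x * B 0 1 * B 0 1) * r) :
    ∃ E₁ ∈ relE I I, ∃ E₂ ∈ relE I I, diagHom v * B * (diagHom v)⁻¹ = E₁ * B * E₂ := by
  set D : SL(2, R) := diagHom v with hD
  -- `F = D E₂₁(xb) D⁻¹ E₁₂(-rb) E₂₁(-xb) ∈ E(I, I)` and `N' = D B D⁻¹ F`
  set F : SL(2, R) := D * e21 (x * B 0 1) * D⁻¹ * e12 (-(r * B 0 1)) * e21 (-(x * B 0 1)) with hF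
  have hFE : F ∈ relE I I :=
    mul_mem (mul_mem (conj_diagHom_mem_relE v (e21_mem_relE (I.mul_mem_left _ hb)))
      (e12_mem_relE (I.neg_mem (I.mul_mem_left _ hb)))) (e21_mem_relE (I.neg_mem (I.mul_mem_left _ hb)))
  set N' : SL(2, R) := D * (B * e21 (x * B 0 1)) * D⁻¹ * e12 (-(r * B 0 1)) * e21 (-(x * B 0 1))
    with hN'
  have hN'F : D * B * D⁻¹ = N' * F⁻¹ := by rw [hN', hF]; group
  -- the entries of `N'`
  obtain ⟨a00, a01, a10, a11⟩ := mul_e21_apply B (x * B 0 1)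
  obtain ⟨b00, b01, b10, b11⟩ := diagHom_conj_apply v (B * e21 (x * B 0 1))
  obtain ⟨c00, c01, c10, c11⟩ := mul_e12_apply (D * (B * e21 (x * B 0 1)) * D⁻¹) (-(r * B 0 1))
  obtain ⟨d00, d01, d10, d11⟩ :=
    mul_e21_apply (D * (B * e21 (x * B 0 1)) * D⁻¹ * e12 (-(r * B 0 1))) (-(x * B 0 1))
  rw [← hD] at b00 b01 b10 b11
  have h01 : N' 0 1 = B 0 1 := by
    rw [hN', d01, c01, b01, b00, a01, a00]
    linear_combination (B 0 1) * hr
  have h00 : N' 0 0 = B 0 0 := by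
    rw [hN', d00, c00, c01, b00, b01, a00, a01]
    linear_combination (-(x * B 0 1 * B 0 1)) * hr
  have h10 : N' 1 0 ∈ I := by
    rw [hN', d10, c10, b10, a10]
    exact I.add_mem (I.mul_mem_left _ (I.add_mem hc (I.mul_mem_left _ (I.mul_mem_left _ hb))))
      (I.mul_mem_left _ (I.neg_mem (I.mul_mem_left _ hb)))
  refine ⟨e21 (N' 1 0 * B 1 1 - N' 1 1 * B 1 0), e21_mem_relE ?_, F⁻¹, inv_mem hFE, ?_⟩
  · exact I.sub_mem (I.mul_mem_right _ h10) (I.mul_mem_left _ hc)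
  · rw [hN'F, ← eq_e21_mul_of_row_eq N' B h00 h01]

/-- The case `b = 0` of Lemma 5: `D B D⁻¹ = B E₂₁(ac(v⁻² - 1))`. [cite: Vaserstein1972SL2, Lemma 5] -/
theorem diagHom_conj_eq_of_apply_01_eq_zero (v : Rˣ) (B : SL(2, R)) (hb : B 0 1 = 0) :
    diagHom v * B * (diagHom v)⁻¹ = B * e21 (B 0 0 * B 1 0 * (↑v⁻¹ * ↑v⁻¹ - 1)) := by
  have hdet := det_two B
  rw [hb, zero_mul, sub_zero] at hdet
  obtain ⟨h00, h01, h10, h11⟩ := diagHom_conj_apply v B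
  obtain ⟨k00, k01, k10, k11⟩ := mul_e21_apply B (B 0 0 * B 1 0 * (↑v⁻¹ * ↑v⁻¹ - 1))
  ext i j
  fin_cases i <;> fin_cases j
  · simp only [Fin.zero_eta, Fin.isValue]
    rw [h00, k00, hb]; ring
  · simp only [Fin.zero_eta, Fin.isValue, Fin.mk_one]
    rw [h01, k01, hb]; ring
  · simp only [Fin.zero_eta, Fin.isValue, Fin.mk_one]
    rw [h10, k10]; linear_combination (-(B 1 0 * (↑v⁻¹ * ↑v⁻¹ - 1))) * hdet
  · simp only [Fin.isValue, Fin.mk_one]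
    rw [h11, k11]

end CommRing

/-! ### Lemma 5 over a ring of integers -/

section NumberField

variable {K : Type} [Field K] [NumberField K]

/-- **Vaserstein 1972, Lemma 5** (`s = m/2 = 1`: `K` has a real place): for a unit `t`,
`T = diag(t, t⁻¹)`, an ideal `I` and `B = (a b; c d) ∈ SL₂(𝓞 K)` with `b, c ∈ I`:
`T B T⁻¹ ∈ E(I, I) B E(I, I)`. [cite: Vaserstein1972SL2, Lemma 5] -/
theorem exists_diagHom_conj_eq (σ : K →+* ℝ) (t : (𝓞 K)ˣ) {I : Ideal (𝓞 K)} (B : SL(2, 𝓞 K))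
    (hb : B 0 1 ∈ I) (hc : B 1 0 ∈ I) :
    ∃ E₁ ∈ relE I I, ∃ E₂ ∈ relE I I, diagHom t * B * (diagHom t)⁻¹ = E₁ * B * E₂ := by
  classical
  by_cases hb0 : B 0 1 = 0
  · refine ⟨1, one_mem _, e21 (B 0 0 * B 1 0 * (↑t⁻¹ * ↑t⁻¹ - 1)),
      e21_mem_relE (I.mul_mem_right _ (I.mul_mem_left _ hc)), ?_⟩
    rw [one_mul, diagHom_conj_eq_of_apply_01_eq_zero t B hb0]
  -- the good exponents form a subgroup of `ℤ`
  let S : AddSubgroup ℤ :=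
    { carrier := {n | ∃ E₁ ∈ relE I I, ∃ E₂ ∈ relE I I,
        diagHom (t ^ n) * B * (diagHom (t ^ n))⁻¹ = E₁ * B * E₂}
      zero_mem' := ⟨1, one_mem _, 1, one_mem _, by simp⟩
      add_mem' := by
        rintro n m ⟨E₁, hE₁, E₂, hE₂, h₁⟩ ⟨E₃, hE₃, E₄, hE₄, h₂⟩
        refine ⟨diagHom (t ^ n) * E₃ * (diagHom (t ^ n))⁻¹ * E₁,
          mul_mem (conj_diagHom_mem_relE _ hE₃) hE₁,
          E₂ * (diagHom (t ^ n) * E₄ * (diagHom (t ^ n))⁻¹),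
          mul_mem hE₂ (conj_diagHom_mem_relE _ hE₄), ?_⟩
        rw [_root_.zpow_add, map_mul]
        calc diagHom (t ^ n) * diagHom (t ^ m) * B * (diagHom (t ^ n) * diagHom (t ^ m))⁻¹
            = diagHom (t ^ n) * (diagHom (t ^ m) * B * (diagHom (t ^ m))⁻¹) *
                (diagHom (t ^ n))⁻¹ := by group
          _ = diagHom (t ^ n) * E₃ * (diagHom (t ^ n))⁻¹ *
                (diagHom (t ^ n) * B * (diagHom (t ^ n))⁻¹) *
                (diagHom (t ^ n) * E₄ * (diagHom (t ^ n))⁻¹) := by rw [h₂]; group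
          _ = _ := by rw [h₁]; group
      neg_mem' := by
        rintro n ⟨E₁, hE₁, E₂, hE₂, h⟩
        refine ⟨(diagHom (t ^ n))⁻¹ * E₁⁻¹ * diagHom (t ^ n),
          diagHom_inv_conj_mem_relE _ (inv_mem hE₁),
          (diagHom (t ^ n))⁻¹ * E₂⁻¹ * diagHom (t ^ n),
          diagHom_inv_conj_mem_relE _ (inv_mem hE₂), ?_⟩
        rw [_root_.zpow_neg, map_inv]
        calc (diagHom (t ^ n))⁻¹ * B * (diagHom (t ^ n))⁻¹⁻¹
            = (diagHom (t ^ n))⁻¹ * E₁⁻¹ * (E₁ * B * E₂) * E₂⁻¹ * diagHom (t ^ n) := by group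
          _ = (diagHom (t ^ n))⁻¹ * E₁⁻¹ * (diagHom (t ^ n) * B * (diagHom (t ^ n))⁻¹) * E₂⁻¹ *
                diagHom (t ^ n) := by rw [h]
          _ = _ := by group }
  have hSmem : ∀ n : ℤ, n ∈ S ↔ ∃ E₁ ∈ relE I I, ∃ E₂ ∈ relE I I,
      diagHom (t ^ n) * B * (diagHom (t ^ n))⁻¹ = E₁ * B * E₂ := fun n ↦ Iff.rfl
  suffices h1 : (1 : ℤ) ∈ S by
    obtain ⟨E₁, hE₁, E₂, hE₂, h⟩ := (hSmem 1).1 h1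
    exact ⟨E₁, hE₁, E₂, hE₂, by simpa using h⟩
  -- `n ∈ S` whenever `t²ⁿ ≡ 1 (mod a + x b²)`
  set a := B 0 0 with ha
  set b := B 0 1 with hbdef
  have hstep : ∀ (x : 𝓞 K) (n : ℕ),
      ((t ^ n : (𝓞 K)ˣ) : 𝓞 K) * ↑(t ^ n) - 1 ∈ Ideal.span {a + x * (b * b)} → (n : ℤ) ∈ S := by
    intro x n hn
    obtain ⟨r, hr⟩ := Ideal.mem_span_singleton'.1 hn
    rw [hSmem, zpow_natCast]
    exact diagHom_conj_mem_of_dvd (t ^ n) B hb hc x r (by rw [← hr, ← ha, ← hbdef]; ring)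
  -- for every prime `l`, an element of `S` prime to `l`
  have hab : IsCoprime a (b * b) := (isCoprime_row B).mul_right (isCoprime_row B)
  have hprime : ∀ l : ℕ, l.Prime → ∃ n : ℕ, n ≠ 0 ∧ ¬ l ∣ n ∧ (n : ℤ) ∈ S := by
    intro l hl
    obtain ⟨x, -, hx⟩ := SerreSL2.exists_add_mul_forall_not_dvd_orderOf σ hab
      (mul_ne_zero hb0 hb0) hl
    set J : Ideal (𝓞 K) := Ideal.span {a + x * (b * b)} with hJ
    set u : (𝓞 K ⧸ J)ˣ := Units.map (Ideal.Quotient.mk J : 𝓞 K →* 𝓞 K ⧸ J) t with hu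
    have hΦ := hx u
    set Φ := orderOf u with hΦdef
    have hΦ0 : Φ ≠ 0 := fun h ↦ hΦ (by rw [h]; exact dvd_zero _)
    have hpow : ∀ N : ℕ, Φ ∣ N → ((t ^ N : (𝓞 K)ˣ) : 𝓞 K) - 1 ∈ J := by
      intro N hN
      have h1 : u ^ N = 1 := orderOf_dvd_iff_pow_eq_one.1 hN
      have h2 := congrArg (fun w : (𝓞 K ⧸ J)ˣ ↦ (w : 𝓞 K ⧸ J)) h1
      simp only [hu, Units.val_pow_eq_pow_val, Units.coe_map, MonoidHom.coe_coe, Units.val_one,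
        ← map_pow] at h2
      rw [← (Ideal.Quotient.mk J).map_one, Ideal.Quotient.eq] at h2
      rwa [Units.val_pow_eq_pow_val]
    -- `n = Φ/2` or `Φ`
    by_cases heven : 2 ∣ Φ
    · obtain ⟨n, hn⟩ := heven
      refine ⟨n, fun h ↦ hΦ0 (by rw [hn, h, mul_zero]), fun hln ↦ hΦ ?_, hstep x n ?_⟩
      · rcases eq_or_ne l 2 with rfl | hl2
        · rw [hn, show padicValNat 2 2 + 1 = 2 by norm_num, pow_two]
          exact mul_dvd_mul_left 2 hln
        · rw [padicValNat.eq_zero_of_not_dvd (fun h ↦ hl2 ((Nat.prime_dvd_prime_iff_eq hl Nat.prime_two).1 h)),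
            zero_add, pow_one, hn]
          exact dvd_mul_of_dvd_right hln 2
      · rw [← Units.val_mul, ← pow_add, ← two_mul, ← hn]
        exact hpow Φ dvd_rfl
    · refine ⟨Φ, hΦ0, fun hlΦ ↦ ?_, hstep x Φ ?_⟩
      · rcases eq_or_ne l 2 with rfl | hl2
        · exact heven hlΦ
        · apply hΦ
          rwa [padicValNat.eq_zero_of_not_dvd (fun h ↦ hl2 ((Nat.prime_dvd_prime_iff_eq hl Nat.prime_two).1 h)),
            zero_add, pow_one]
      · rw [← Units.val_mul, ← pow_add]
        exact hpow (Φ + Φ) (dvd_add dvd_rfl dvd_rfl)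
  -- hence `S = ℤ`
  set S' : Submodule ℤ ℤ := AddSubgroup.toIntSubmodule S with hS'
  haveI : S'.IsPrincipal := IsPrincipalIdealRing.principal S'
  set g : ℤ := Submodule.IsPrincipal.generator S' with hg
  have hgS : g ∈ S := Submodule.IsPrincipal.generator_mem S'
  have hgdvd : ∀ n : ℤ, n ∈ S → g ∣ n := fun n hn ↦
    (Submodule.IsPrincipal.mem_iff_generator_dvd S').1 hn
  have hg1 : g.natAbs = 1 := by
    by_contra hne
    obtain ⟨l, hl, hlg⟩ := Nat.exists_prime_and_dvd hne
    obtain ⟨n, -, hln, hnS⟩ := hprime l hl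
    refine hln ?_
    have := (Int.natAbs_dvd_natAbs.2 (hgdvd n hnS))
    rw [Int.natAbs_natCast] at this
    exact hlg.trans this
  rcases Int.natAbs_eq g with h | h
  · rw [hg1] at h; rw [← show g = 1 from h]; exact hgS
  · rw [hg1] at h
    have : (1 : ℤ) = -g := by rw [h]; ring
    rw [this]; exact S.neg_mem hgS

end NumberField

end SL2Rel

end Literature.NumberTheory.Automorphic
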